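import Mathlib.LinearAlgebra.Matrix.NonsingularInverse
import Mathlib.LinearAlgebra.Matrix.Trace
import Mathlib.Tactic.Ring
import Mathlib.Tactic.LinearCombination
import HarnessLib

/-!
# The five `SU(2)` surplus identities of the kinematical completeness audit, kernel-checked
(cell `gauge-boot`, ENG-1 / F2, algebraic addendum)

Honest framing (cell rule): certified bounds on lattice expectations at stated coupling, gauge group, dimension and
torus size; NOT a mass gap, NOT a continuum limit, NOT a string tension; not summit-bearing
(`FixedCouplingUltralocality`, `PerturbativeInvisibility`).  This file is plain `2 × 2` matrix algebra and carries no
bound; no certificate, index row or table of the cell depends on it.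

The kinematical completeness audit of the cell's `SU(2)` variable sets (eng1, KIN-CENSUS-G1 §A–§G; loop lane,
COMPLETENESS.md §5(iii)) compares, for each variable set of record, the dimension of the space of β-independent linear
identities among its loop variables (UPPER, a kernel rank) with the rank of the generators' trace rows supported on the
set (LOWER).  Every `D = 3, 4` set of record and every other `2D` set is COMPLETE (UPPER = LOWER) except two, whose
surplus vectors were extracted exactly and then PROVED by the loop lane as class images of local pointwise `SL₂` trace
identities (exact Laurent-polynomial expansion, `kzl3surplus/sympoly.py`, `localid_nd/exact_nd.py`):
* the `2D` calibration Gram set kz-L3 (`8 335` loops): `dim = 3 905 + 3 = 3 908`, surplus = **K1, K2, K3** (KZL3-SURPLUS.md);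
* the `4D` H-only canary set glyz-c3 (`19 769` loops): `dim = 10 633 + 2 = 10 635`, surplus = **J1, J2** (GLYZC3D4-SURPLUS.md).
This file KERNEL-CHECKS the five pointwise identities exactly as printed there: each is an identity
`Σ_j d_j · tr w_j = 0`, `d_j = ±1`, among traces of free-group words `w_j` in the cotree link variables of a gauge-fixed
box, valid for all `2 × 2` matrices of determinant one over ANY commutative ring (hence on `SL₂(ℂ)`, hence on `SU(2)`,
hence pointwise for every lattice configuration).  For each identity two forms are proved:
* `<name>_adjugate` — HYPOTHESIS-FREE and homogeneous: inverses replaced by adjugates and each term multiplied by the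
  determinants `det g` of the generators `g` it is two letters short in (every term then has the same multidegree); a
  polynomial identity in the `4·k` matrix entries, closed by `ring`;
* `<name>` — the `SL₂` form with honest inverses under `det g = 1` (adjugate = inverse, determinant factors = 1).
The only algebraic input behind all five is Cayley–Hamilton for `2 × 2` matrices, i.e. the Fricke–Vogt identity
`tr A · tr B = tr (A B) + tr (A · adj B)` (tree: `trace_mul_trace_su_two`; K2 is an explicit four-difference
combination of its instances, KZL3-SURPLUS.md §2) — but the kernel check below does not go through a derivation: it
verifies each expanded identity outright.
NOT kernel-checked here (bookkeeping of record in the two loop-lane files, shas in their SHA256SUMS): the translation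
lattice word ↔ gauge word of each placed loop and the class-image computation (orbit sizes) that turns a pointwise
identity into the audit's class vector; the lattice word of every term is quoted in the docstrings for cross-reference
(`a/A, b/B, c/C, d/D` = `±` unit steps in the four lattice directions; `@ v` = start vertex).
Sources of record (sha256 prefixes): KZL3-SURPLUS.md `cc685568`, `kzl3surplus/id13_exact.out` `466f93ab` (K1 = #1,
K3 = #3), `kzl3surplus/K2_exact.out` `38fc4133`; GLYZC3D4-SURPLUS.md `82faeacd`, `glyzc3d4/freewords.txt` `c06b98bd`
(J1, J2); eng1's extracted vectors: `kin_census/kzl3_surplus.md`, `kin_census/glyzc3_D4_surplus_M6_ct.json`.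
-/

namespace Summit.QuantumFields.GaugeBoot

open scoped Matrix

section CommRing

variable {R : Type*} [CommRing R]

/-- Entry `(0,0)` of the adjugate of a `2 × 2` matrix. [folklore] -/
theorem adjugate_fin_two_apply_zero_zero (M : Matrix (Fin 2) (Fin 2) R) : M.adjugate 0 0 = M 1 1 := by
  rw [Matrix.adjugate_fin_two]; simp

/-- Entry `(0,1)` of the adjugate of a `2 × 2` matrix. [folklore] -/
theorem adjugate_fin_two_apply_zero_one (M : Matrix (Fin 2) (Fin 2) R) : M.adjugate 0 1 = -M 0 1 := by
  rw [Matrix.adjugate_fin_two]; simp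

/-- Entry `(1,0)` of the adjugate of a `2 × 2` matrix. [folklore] -/
theorem adjugate_fin_two_apply_one_zero (M : Matrix (Fin 2) (Fin 2) R) : M.adjugate 1 0 = -M 1 0 := by
  rw [Matrix.adjugate_fin_two]; simp

/-- Entry `(1,1)` of the adjugate of a `2 × 2` matrix. [folklore] -/
theorem adjugate_fin_two_apply_one_one (M : Matrix (Fin 2) (Fin 2) R) : M.adjugate 1 1 = M 0 0 := by
  rw [Matrix.adjugate_fin_two]; simp

/-- `det M = 1 ⟹ M⁻¹ = adj M` (`2 × 2`; the `SL₂` inverse). [folklore] -/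
theorem inv_eq_adjugate_fin_two_of_det_eq_one (M : Matrix (Fin 2) (Fin 2) R) (h : M.det = 1) :
    M⁻¹ = M.adjugate := by
  rw [Matrix.inv_def, h, Ring.inverse_one, one_smul]

/-- **K2 (kz-L3 2D surplus vector #2, support 6; eight placed loops of its classes 1, 2, 3, 3, 4, 4, 5, 6) — hypothesis-free homogeneous form**
(inverses ↦ adjugates, determinant factors inserted): a polynomial identity in the entries of 5 arbitrary
`2 × 2` matrices over a commutative ring.  Generators = cotree links in the
row gauge of the `2 × 3` box of plaquettes (KZL3-SURPLUS.md §2). [cell audit; consequence of Cayley–Hamilton] -/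
theorem kzL3D2_surplus_K2_adjugate (P0 P2 R0 R1 R2 : Matrix (Fin 2) (Fin 2) R) :
    (R0 * R1 * P2 * R2.adjugate * P2 * P0.adjugate * P0.adjugate).trace
      - P0.det * P2.det * (R0 * R2 * R1.adjugate).trace
      + (R0 * R1 * P2 * R2.adjugate * P2.adjugate * P0.adjugate * P0.adjugate).trace
      + (P0.adjugate * R0.adjugate * P0 * R1 * P2 * R2.adjugate * P2).trace
      - P0.det * (R0 * R2 * P2.adjugate * P2.adjugate * R1.adjugate).trace
      - P2.det * (R1.adjugate * P0 * R0.adjugate * P0 * R2).trace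
      - (R1 * P2 * P2 * R2.adjugate * P0.adjugate * R0 * P0.adjugate).trace
      + (R2 * P2.adjugate * R1.adjugate * P0.adjugate * R0 * P0 * P2).trace = 0 := by
  simp only [Matrix.trace_fin_two, Matrix.mul_apply, Fin.sum_univ_two, Matrix.det_fin_two,
    adjugate_fin_two_apply_zero_zero, adjugate_fin_two_apply_zero_one, adjugate_fin_two_apply_one_zero,
    adjugate_fin_two_apply_one_one]
  ring

/-- **K2 (kz-L3 2D surplus vector #2, support 6; eight placed loops of its classes 1, 2, 3, 3, 4, 4, 5, 6)** on `SL₂(R)`: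
for `2 × 2` matrices of determinant one over any commutative ring, the signed sum of the following word traces
vanishes (terms in the order of the audit's class vector; lattice word of the placed loop of record next to each):
  `+ tr(R0·R1·P2·R2⁻¹·P2·P0⁻¹·P0⁻¹)`  ↔ lattice `abbAbaBAbABBaBAbaB`
  `− tr(R0·R2·R1⁻¹)`  ↔ lattice `aabAAbaabAABaaBAAB`
  `+ tr(R0·R1·P2·R2⁻¹·P2⁻¹·P0⁻¹·P0⁻¹)`  ↔ lattice `abbAbaBAAbaBABaBAbaB`
  `+ tr(P0⁻¹·R0⁻¹·P0·R1·P2·R2⁻¹·P2)`  ↔ lattice `aBAbaaBAbabAbaBAbABB`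
  `− tr(R0·R2·P2⁻¹·P2⁻¹·R1⁻¹)`  ↔ lattice `aabAAbaabABAbaBaBAAB`
  `− tr(R1⁻¹·P0·R0⁻¹·P0·R2)`  ↔ lattice `aaBAABabaBAbAbaabAAB`
  `− tr(R1·P2·P2·R2⁻¹·P0⁻¹·R0·P0⁻¹)`  ↔ lattice `baabAbABabaBAABaBabABA`
  `+ tr(R2·P2⁻¹·R1⁻¹·P0⁻¹·R0·P0·P2)`  ↔ lattice `aabABaBABabAABabAbabAB`
[cell audit; consequence of Cayley–Hamilton] -/
theorem kzL3D2_surplus_K2 (P0 P2 R0 R1 R2 : Matrix (Fin 2) (Fin 2) R)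
    (hP0 : P0.det = 1) (hP2 : P2.det = 1) (hR0 : R0.det = 1) (hR1 : R1.det = 1) (hR2 : R2.det = 1) :
    (R0 * R1 * P2 * R2⁻¹ * P2 * P0⁻¹ * P0⁻¹).trace
      - (R0 * R2 * R1⁻¹).trace
      + (R0 * R1 * P2 * R2⁻¹ * P2⁻¹ * P0⁻¹ * P0⁻¹).trace
      + (P0⁻¹ * R0⁻¹ * P0 * R1 * P2 * R2⁻¹ * P2).trace
      - (R0 * R2 * P2⁻¹ * P2⁻¹ * R1⁻¹).trace
      - (R1⁻¹ * P0 * R0⁻¹ * P0 * R2).trace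
      - (R1 * P2 * P2 * R2⁻¹ * P0⁻¹ * R0 * P0⁻¹).trace
      + (R2 * P2⁻¹ * R1⁻¹ * P0⁻¹ * R0 * P0 * P2).trace = 0 := by
  have H := kzL3D2_surplus_K2_adjugate P0 P2 R0 R1 R2
  simp only [hP0, hP2, one_mul] at H
  rw [inv_eq_adjugate_fin_two_of_det_eq_one P0 hP0,
    inv_eq_adjugate_fin_two_of_det_eq_one P2 hP2,
    inv_eq_adjugate_fin_two_of_det_eq_one R0 hR0,
    inv_eq_adjugate_fin_two_of_det_eq_one R1 hR1,
    inv_eq_adjugate_fin_two_of_det_eq_one R2 hR2]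
  linear_combination H

/-- **K1 (kz-L3 2D surplus vector #1, support 12) — hypothesis-free homogeneous form**
(inverses ↦ adjugates, determinant factors inserted): a polynomial identity in the entries of 6 arbitrary
`2 × 2` matrices over a commutative ring.  Generators = cotree links in the
row gauge of the `2 × 3` box of plaquettes (KZL3-SURPLUS.md §1, §3: `P_y` = plaquette `[0,1]×[y,y+1]`, `R_y` =
`2×1` rectangle `[0,2]×[y,y+1]`, both based at the origin through the tree). [cell audit; consequence of Cayley–Hamilton] -/
theorem kzL3D2_surplus_K1_adjugate (P0 P1 P2 R0 R1 R2 : Matrix (Fin 2) (Fin 2) R) :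
    P1.det * (R2.adjugate * R1.adjugate * R0.adjugate * P0 * P1 * P2 * P2).trace
      - P1.det * P2.det * (P0 * P1 * R2 * R1.adjugate * R0.adjugate).trace
      + P1.det * (P2.adjugate * P1.adjugate * P0.adjugate * R0 * R1 * P2 * R2.adjugate).trace
      - (P0 * P1 * P2 * R2.adjugate * R1.adjugate * P1 * P2 * P1.adjugate * R0.adjugate).trace
      - P2.det * (P0 * P1 * R2 * P1.adjugate * R1 * P1.adjugate * R0.adjugate).trace
      - (P0 * P1 * P2 * R2.adjugate * P1.adjugate * R1 * P2 * P1.adjugate * R0.adjugate).trace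
      + P1.det * P2.det * (P0 * P1 * R2 * R1 * R0.adjugate).trace
      - (P0 * P1 * P2 * P1 * R1 * R2 * P2.adjugate * P1.adjugate * R0.adjugate).trace
      + P1.det * (P0 * P1 * P2 * R2.adjugate * P2 * R1 * R0.adjugate).trace
      + P2.det * (P0 * P1 * R2 * R1 * P1.adjugate * P1.adjugate * R0.adjugate).trace
      - (P0 * P1 * P2 * P1 * R1 * P2 * R2.adjugate * P1.adjugate * R0.adjugate).trace
      + (P0 * P1 * P2 * R2.adjugate * P2 * R1 * P1.adjugate * P1.adjugate * R0.adjugate).trace = 0 := by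
  simp only [Matrix.trace_fin_two, Matrix.mul_apply, Fin.sum_univ_two, Matrix.det_fin_two,
    adjugate_fin_two_apply_zero_zero, adjugate_fin_two_apply_zero_one, adjugate_fin_two_apply_one_zero,
    adjugate_fin_two_apply_one_one]
  ring

/-- **K1 (kz-L3 2D surplus vector #1, support 12)** on `SL₂(R)`:
for `2 × 2` matrices of determinant one over any commutative ring, the signed sum of the following word traces
vanishes (terms in the order of the audit's class vector; lattice word of the placed loop of record next to each):
  `+ tr(R2⁻¹·R1⁻¹·R0⁻¹·P0·P1·P2·P2)`  ↔ lattice `aBBBAbbbABab`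
  `− tr(P0·P1·R2·R1⁻¹·R0⁻¹)`  ↔ lattice `bbabAABaaBBA`
  `+ tr(P2⁻¹·P1⁻¹·P0⁻¹·R0·R1·P2·R2⁻¹)`  ↔ lattice `baBBBabbAbaBAA`
  `− tr(P0·P1·P2·R2⁻¹·R1⁻¹·P1·P2·P1⁻¹·R0⁻¹)`  ↔ lattice `bbbaBBAbbABaBaBA`
  `− tr(P0·P1·R2·P1⁻¹·R1·P1⁻¹·R0⁻¹)`  ↔ lattice `bbabAABaBabABaBA`
  `− tr(P0·P1·P2·R2⁻¹·P1⁻¹·R1·P2·P1⁻¹·R0⁻¹)`  ↔ lattice `bbbaBABabAbABaBaBA`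
  `+ tr(P0·P1·R2·R1·R0⁻¹)`  ↔ lattice `bbabAABBaabAABaaBA`
  `− tr(P0·P1·P2·P1·R1·R2·P2⁻¹·P1⁻¹·R0⁻¹)`  ↔ lattice `bbbABBabABaabbABBaBA`
  `+ tr(P0·P1·P2·R2⁻¹·P2·R1·R0⁻¹)`  ↔ lattice `bbbaBAbABBaabAABaaBA`
  `+ tr(P0·P1·R2·R1·P1⁻¹·P1⁻¹·R0⁻¹)`  ↔ lattice `bbabAABBaabABAbaBaBA`
  `− tr(P0·P1·P2·P1·R1·P2·R2⁻¹·P1⁻¹·R0⁻¹)`  ↔ lattice `bbbABBabABaabAbaBABaBA`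
  `+ tr(P0·P1·P2·R2⁻¹·P2·R1·P1⁻¹·P1⁻¹·R0⁻¹)`  ↔ lattice `bbbaBAbABBaabABAbaBaBA`
[cell audit; consequence of Cayley–Hamilton] -/
theorem kzL3D2_surplus_K1 (P0 P1 P2 R0 R1 R2 : Matrix (Fin 2) (Fin 2) R)
    (hP0 : P0.det = 1) (hP1 : P1.det = 1) (hP2 : P2.det = 1) (hR0 : R0.det = 1) (hR1 : R1.det = 1) (hR2 : R2.det = 1) :
    (R2⁻¹ * R1⁻¹ * R0⁻¹ * P0 * P1 * P2 * P2).trace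
      - (P0 * P1 * R2 * R1⁻¹ * R0⁻¹).trace
      + (P2⁻¹ * P1⁻¹ * P0⁻¹ * R0 * R1 * P2 * R2⁻¹).trace
      - (P0 * P1 * P2 * R2⁻¹ * R1⁻¹ * P1 * P2 * P1⁻¹ * R0⁻¹).trace
      - (P0 * P1 * R2 * P1⁻¹ * R1 * P1⁻¹ * R0⁻¹).trace
      - (P0 * P1 * P2 * R2⁻¹ * P1⁻¹ * R1 * P2 * P1⁻¹ * R0⁻¹).trace
      + (P0 * P1 * R2 * R1 * R0⁻¹).trace
      - (P0 * P1 * P2 * P1 * R1 * R2 * P2⁻¹ * P1⁻¹ * R0⁻¹).trace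
      + (P0 * P1 * P2 * R2⁻¹ * P2 * R1 * R0⁻¹).trace
      + (P0 * P1 * R2 * R1 * P1⁻¹ * P1⁻¹ * R0⁻¹).trace
      - (P0 * P1 * P2 * P1 * R1 * P2 * R2⁻¹ * P1⁻¹ * R0⁻¹).trace
      + (P0 * P1 * P2 * R2⁻¹ * P2 * R1 * P1⁻¹ * P1⁻¹ * R0⁻¹).trace = 0 := by
  have H := kzL3D2_surplus_K1_adjugate P0 P1 P2 R0 R1 R2
  simp only [hP1, hP2, one_mul] at H
  rw [inv_eq_adjugate_fin_two_of_det_eq_one P0 hP0,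
    inv_eq_adjugate_fin_two_of_det_eq_one P1 hP1,
    inv_eq_adjugate_fin_two_of_det_eq_one P2 hP2,
    inv_eq_adjugate_fin_two_of_det_eq_one R0 hR0,
    inv_eq_adjugate_fin_two_of_det_eq_one R1 hR1,
    inv_eq_adjugate_fin_two_of_det_eq_one R2 hR2]
  linear_combination H

/-- **K3 (kz-L3 2D surplus vector #3, support 14) — hypothesis-free homogeneous form**
(inverses ↦ adjugates, determinant factors inserted): a polynomial identity in the entries of 5 arbitrary
`2 × 2` matrices over a commutative ring.  Generators = cotree links in the
row gauge of the `2 × 3` box of plaquettes (KZL3-SURPLUS.md §3). [cell audit; consequence of Cayley–Hamilton] -/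
theorem kzL3D2_surplus_K3_adjugate (P0 P1 P2 R1 R2 : Matrix (Fin 2) (Fin 2) R) :
    -(P1.det * P2.det * R1.det * (P0.adjugate * P1 * R2).trace)
      + P1.det * P2.det * R1.det * (P0 * P1 * R2.adjugate).trace
      - P1.det * R1.det * (P2.adjugate * P1.adjugate * P0.adjugate * P2 * R2).trace
      - P1.det * R1.det * (P2.adjugate * P1.adjugate * P0 * P2 * R2).trace
      + P2.det * R1.det * (P0 * P1 * R2.adjugate * P1.adjugate * P1.adjugate).trace
      - P1.det * R1.det * (R2.adjugate * P1.adjugate * P0 * P2 * P2).trace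
      + R1.det * (P0 * P1 * P2 * P1.adjugate * P2 * R2.adjugate * P1.adjugate).trace
      - P1.det * (R2.adjugate * R1.adjugate * P0.adjugate * P1 * P2 * R1 * P2).trace
      + P1.det * P2.det * (P0 * P1 * R2 * R1.adjugate * R1.adjugate).trace
      - (P2.adjugate * P1.adjugate * P0 * P1 * R1.adjugate * P1 * R2 * P2.adjugate * R1.adjugate).trace
      + P1.det * (P0 * P1 * R2 * P2.adjugate * P2.adjugate * R1.adjugate * R1.adjugate).trace
      + P2.det * (P0 * P1 * R2 * R1.adjugate * P1.adjugate * R1 * P1.adjugate).trace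
      - (P0 * P1 * R2 * P2.adjugate * R1.adjugate * P1 * R1.adjugate * P2 * P1.adjugate).trace
      + (P0 * P1 * R2 * P2.adjugate * P2.adjugate * R1.adjugate * P1.adjugate * R1 * P1.adjugate).trace = 0 := by
  simp only [Matrix.trace_fin_two, Matrix.mul_apply, Fin.sum_univ_two, Matrix.det_fin_two,
    adjugate_fin_two_apply_zero_zero, adjugate_fin_two_apply_zero_one, adjugate_fin_two_apply_one_zero,
    adjugate_fin_two_apply_one_one]
  ring

/-- **K3 (kz-L3 2D surplus vector #3, support 14)** on `SL₂(R)`: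
for `2 × 2` matrices of determinant one over any commutative ring, the signed sum of the following word traces
vanishes (terms in the order of the audit's class vector; lattice word of the placed loop of record next to each):
  `− tr(P0⁻¹·P1·R2)`  ↔ lattice `aBAbababAABB`
  `+ tr(P0·P1·R2⁻¹)`  ↔ lattice `abbAbaaBAABB`
  `− tr(P2⁻¹·P1⁻¹·P0⁻¹·P2·R2)`  ↔ lattice `BBBAbbabABaabA`
  `− tr(P2⁻¹·P1⁻¹·P0·P2·R2)`  ↔ lattice `BBABabAbabABaabA`
  `+ tr(P0·P1·R2⁻¹·P1⁻¹·P1⁻¹)`  ↔ lattice `abbAbaaBABAbaBAB`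
  `− tr(R2⁻¹·P1⁻¹·P0·P2·P2)`  ↔ lattice `aBABABabAbabABab`
  `+ tr(P0·P1·P2·P1⁻¹·P2·R2⁻¹·P1⁻¹)`  ↔ lattice `abbbABaBAbabaBABAB`
  `− tr(R2⁻¹·R1⁻¹·P0⁻¹·P1·P2·R1·P2)`  ↔ lattice `aBBABAbabbABBaabAb`
  `+ tr(P0·P1·R2·R1⁻¹·R1⁻¹)`  ↔ lattice `abbabAABaaBAAbaaBAAB`
  `− tr(P2⁻¹·P1⁻¹·P0·P1·R1⁻¹·P1·R2·P2⁻¹·R1⁻¹)`  ↔ lattice `bbaBBABabbaBAbabABaBAA`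
  `+ tr(P0·P1·R2·P2⁻¹·P2⁻¹·R1⁻¹·R1⁻¹)`  ↔ lattice `abbabABAbaBaBAAbaaBAAB`
  `+ tr(P0·P1·R2·R1⁻¹·P1⁻¹·R1·P1⁻¹)`  ↔ lattice `abbabAABaaBAAbaBabABAB`
  `− tr(P0·P1·R2·P2⁻¹·R1⁻¹·P1·R1⁻¹·P2·P1⁻¹)`  ↔ lattice `abbabABaBAbaBAAbabABaBAB`
  `+ tr(P0·P1·R2·P2⁻¹·P2⁻¹·R1⁻¹·P1⁻¹·R1·P1⁻¹)`  ↔ lattice `abbabABAbaBaBAAbaBabABAB`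
[cell audit; consequence of Cayley–Hamilton] -/
theorem kzL3D2_surplus_K3 (P0 P1 P2 R1 R2 : Matrix (Fin 2) (Fin 2) R)
    (hP0 : P0.det = 1) (hP1 : P1.det = 1) (hP2 : P2.det = 1) (hR1 : R1.det = 1) (hR2 : R2.det = 1) :
    -(P0⁻¹ * P1 * R2).trace
      + (P0 * P1 * R2⁻¹).trace
      - (P2⁻¹ * P1⁻¹ * P0⁻¹ * P2 * R2).trace
      - (P2⁻¹ * P1⁻¹ * P0 * P2 * R2).trace
      + (P0 * P1 * R2⁻¹ * P1⁻¹ * P1⁻¹).trace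
      - (R2⁻¹ * P1⁻¹ * P0 * P2 * P2).trace
      + (P0 * P1 * P2 * P1⁻¹ * P2 * R2⁻¹ * P1⁻¹).trace
      - (R2⁻¹ * R1⁻¹ * P0⁻¹ * P1 * P2 * R1 * P2).trace
      + (P0 * P1 * R2 * R1⁻¹ * R1⁻¹).trace
      - (P2⁻¹ * P1⁻¹ * P0 * P1 * R1⁻¹ * P1 * R2 * P2⁻¹ * R1⁻¹).trace
      + (P0 * P1 * R2 * P2⁻¹ * P2⁻¹ * R1⁻¹ * R1⁻¹).trace
      + (P0 * P1 * R2 * R1⁻¹ * P1⁻¹ * R1 * P1⁻¹).trace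
      - (P0 * P1 * R2 * P2⁻¹ * R1⁻¹ * P1 * R1⁻¹ * P2 * P1⁻¹).trace
      + (P0 * P1 * R2 * P2⁻¹ * P2⁻¹ * R1⁻¹ * P1⁻¹ * R1 * P1⁻¹).trace = 0 := by
  have H := kzL3D2_surplus_K3_adjugate P0 P1 P2 R1 R2
  simp only [hP1, hP2, hR1, one_mul] at H
  rw [inv_eq_adjugate_fin_two_of_det_eq_one P0 hP0,
    inv_eq_adjugate_fin_two_of_det_eq_one P1 hP1,
    inv_eq_adjugate_fin_two_of_det_eq_one P2 hP2,
    inv_eq_adjugate_fin_two_of_det_eq_one R1 hR1,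
    inv_eq_adjugate_fin_two_of_det_eq_one R2 hR2]
  linear_combination H

/-- **J1 (glyz-c3-4D surplus vector 1, support 8; a `2 × 1 × 1` box, three directions) — hypothesis-free homogeneous form**
(inverses ↦ adjugates, determinant factors inserted): a polynomial identity in the entries of 5 arbitrary
`2 × 2` matrices over a commutative ring.  Generators = cotree links in the
BFS-tree gauge of the `2 × 1 × 1` box (GLYZC3D4-SURPLUS.md §2(c): cotree generators `x = g(100,101)`, `y =
g(100,110)`, `z = g(101,111)`, `u = g(110,111)`, `v = g(200,210)`). [cell audit; consequence of Cayley–Hamilton] -/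
theorem glyzc3D4_surplus_J1_adjugate (u v x y z : Matrix (Fin 2) (Fin 2) R) :
    -(x.det * y.det * z.det * (v * u).trace)
      - x.det * z.det * (y * v.adjugate * y * u).trace
      - (v * y.adjugate * x * z * u.adjugate * y.adjugate * x * z).trace
      - (y * v.adjugate * x * z * u.adjugate * y.adjugate * x * z).trace
      + y.det * (x.adjugate * v * u * z.adjugate * x * z).trace
      + (v * y.adjugate * x * z * z * u.adjugate * y.adjugate * x).trace
      + (y * v.adjugate * x * z * z * u.adjugate * y.adjugate * x).trace
      + (y * v.adjugate * y * u * z.adjugate * x * z * x.adjugate).trace = 0 := by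
  simp only [Matrix.trace_fin_two, Matrix.mul_apply, Fin.sum_univ_two, Matrix.det_fin_two,
    adjugate_fin_two_apply_zero_zero, adjugate_fin_two_apply_zero_one, adjugate_fin_two_apply_one_zero,
    adjugate_fin_two_apply_one_one]
  ring

/-- **J1 (glyz-c3-4D surplus vector 1, support 8; a `2 × 1 × 1` box, three directions)** on `SL₂(R)`:
for `2 × 2` matrices of determinant one over any commutative ring, the signed sum of the following word traces
vanishes (terms in the order of the audit's class vector; lattice word of the placed loop of record next to each):
  `− tr(v·u)`  ↔ lattice `aabAcABC @ 000`
  `− tr(y·v⁻¹·y·u)`  ↔ lattice `abaBAbcABC @ 000`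
  `− tr(v·y⁻¹·x·z·u⁻¹·y⁻¹·x·z)`  ↔ lattice `aabABcbCBcbABC @ 000`
  `− tr(y·v⁻¹·x·z·u⁻¹·y⁻¹·x·z)`  ↔ lattice `abaBAcbCBcbABC @ 000`
  `+ tr(x⁻¹·v·u·z⁻¹·x·z)`  ↔ lattice `aCabAcBACacbAB @ 001`
  `+ tr(v·y⁻¹·x·z·z·u⁻¹·y⁻¹·x)`  ↔ lattice `aabABcbABabCBcAC @ 000`
  `+ tr(y·v⁻¹·x·z·z·u⁻¹·y⁻¹·x)`  ↔ lattice `abaBAcbABabCBcAC @ 000`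
  `+ tr(y·v⁻¹·y·u·z⁻¹·x·z·x⁻¹)`  ↔ lattice `baBAbcBACacbABaC @ 100`
[cell audit; consequence of Cayley–Hamilton] -/
theorem glyzc3D4_surplus_J1 (u v x y z : Matrix (Fin 2) (Fin 2) R)
    (hu : u.det = 1) (hv : v.det = 1) (hx : x.det = 1) (hy : y.det = 1) (hz : z.det = 1) :
    -(v * u).trace
      - (y * v⁻¹ * y * u).trace
      - (v * y⁻¹ * x * z * u⁻¹ * y⁻¹ * x * z).trace
      - (y * v⁻¹ * x * z * u⁻¹ * y⁻¹ * x * z).trace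
      + (x⁻¹ * v * u * z⁻¹ * x * z).trace
      + (v * y⁻¹ * x * z * z * u⁻¹ * y⁻¹ * x).trace
      + (y * v⁻¹ * x * z * z * u⁻¹ * y⁻¹ * x).trace
      + (y * v⁻¹ * y * u * z⁻¹ * x * z * x⁻¹).trace = 0 := by
  have H := glyzc3D4_surplus_J1_adjugate u v x y z
  simp only [hx, hy, hz, one_mul] at H
  rw [inv_eq_adjugate_fin_two_of_det_eq_one u hu,
    inv_eq_adjugate_fin_two_of_det_eq_one v hv,
    inv_eq_adjugate_fin_two_of_det_eq_one x hx,
    inv_eq_adjugate_fin_two_of_det_eq_one y hy,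
    inv_eq_adjugate_fin_two_of_det_eq_one z hz]
  linear_combination H

/-- **J2 (glyz-c3-4D surplus vector 2, support 8; the unit `4`-cube) — hypothesis-free homogeneous form**
(inverses ↦ adjugates, determinant factors inserted): a polynomial identity in the entries of 4 arbitrary
`2 × 2` matrices over a commutative ring.  Generators = cotree links in the
BFS-tree gauge of the unit `4`-cube (GLYZC3D4-SURPLUS.md §2(c): cotree generators `x = g(0010,0011)`, `y =
g(1000,1010)`, `z = g(1000,1100)`, `u = g(1010,1011)`). [cell audit; consequence of Cayley–Hamilton] -/
theorem glyzc3D4_surplus_J2_adjugate (u x y z : Matrix (Fin 2) (Fin 2) R) :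
    -(x.det * (z * y * u).trace)
      + (x * x * u.adjugate * y.adjugate * z).trace
      - x.det * (y.adjugate * u * z.adjugate).trace
      - x.det * (y * z.adjugate * u.adjugate).trace
      - (x * u.adjugate * x * y.adjugate * z).trace
      + (u * x.adjugate * y.adjugate * x * z).trace
      + (u * x.adjugate * y.adjugate * x * z.adjugate).trace
      + (z * y * x * u * x.adjugate).trace = 0 := by
  simp only [Matrix.trace_fin_two, Matrix.mul_apply, Fin.sum_univ_two, Matrix.det_fin_two,
    adjugate_fin_two_apply_zero_zero, adjugate_fin_two_apply_zero_one, adjugate_fin_two_apply_one_zero,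
    adjugate_fin_two_apply_one_one]
  ring

/-- **J2 (glyz-c3-4D surplus vector 2, support 8; the unit `4`-cube)** on `SL₂(R)`:
for `2 × 2` matrices of determinant one over any commutative ring, the signed sum of the following word traces
vanishes (terms in the order of the audit's class vector; lattice word of the placed loop of record next to each):
  `− tr(z·y·u)`  ↔ lattice `abABacdACD @ 0000`
  `+ tr(x·x·u⁻¹·y⁻¹·z)`  ↔ lattice `cdCDcdaDCbAB @ 0000`
  `− tr(y⁻¹·u·z⁻¹)`  ↔ lattice `AcaCAcadACDbaB @ 1000`
  `− tr(y·z⁻¹·u⁻¹)`  ↔ lattice `ACacACbaBAdcaD @ 1010`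
  `− tr(x·u⁻¹·x·y⁻¹·z)`  ↔ lattice `daDAdCDcaCbABc @ 0010`
  `+ tr(u·x⁻¹·y⁻¹·x·z)`  ↔ lattice `adADaCAcdCDabABc @ 0010`
  `+ tr(u·x⁻¹·y⁻¹·x·z⁻¹)`  ↔ lattice `adADaCAcdCDbaBAc @ 0010`
  `+ tr(z·y·x·u·x⁻¹)`  ↔ lattice `abABacAdCDcadADC @ 0000`
[cell audit; consequence of Cayley–Hamilton] -/
theorem glyzc3D4_surplus_J2 (u x y z : Matrix (Fin 2) (Fin 2) R)
    (hu : u.det = 1) (hx : x.det = 1) (hy : y.det = 1) (hz : z.det = 1) :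
    -(z * y * u).trace
      + (x * x * u⁻¹ * y⁻¹ * z).trace
      - (y⁻¹ * u * z⁻¹).trace
      - (y * z⁻¹ * u⁻¹).trace
      - (x * u⁻¹ * x * y⁻¹ * z).trace
      + (u * x⁻¹ * y⁻¹ * x * z).trace
      + (u * x⁻¹ * y⁻¹ * x * z⁻¹).trace
      + (z * y * x * u * x⁻¹).trace = 0 := by
  have H := glyzc3D4_surplus_J2_adjugate u x y z
  simp only [hx, one_mul] at H
  rw [inv_eq_adjugate_fin_two_of_det_eq_one u hu,
    inv_eq_adjugate_fin_two_of_det_eq_one x hx,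
    inv_eq_adjugate_fin_two_of_det_eq_one y hy,
    inv_eq_adjugate_fin_two_of_det_eq_one z hz]
  linear_combination H

end CommRing

end Summit.QuantumFields.GaugeBoot
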